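import Literature.NumberTheory.Rogawski1990.RankOneUnstableTransferNonsplit          -- ★ ED. 4 (p842970): `RankOneUnstableTransferNonsplitCME`, `RankOneUnstableTransferNonsplitCMERamified` (the residue this file splits)
import HarnessLib

/-!
# [Rogawski1990 Lemma 4.9.3; LabesseLanglands1979 §2] (R1-lc) The WILD-ramified residue of the rank-one unstable transfer letter:
# `RankOneUnstableTransferNonsplitCMERamified` restricted to the DYADIC ramified non-split places — stated ONCE as a named fact

Topic `NumberTheory/Rogawski1990`; namespace `Literature.NumberTheory.Rogawski1990`.  STATEMENT FILE: one closed `def … : Prop` + its `Iff.rfl` unfolding; no theorem with a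
proof body, no instance, no notation, no `sorry`.  Net debt: +1 named fact «R1-CM-ram-wild» (count-neutral for the books until the pen's «N6nsGerm» ED. 1.11∕1.12 —
architect A-p16 (g27) RULING A-23 (a)).  Cell `pub/hodgecm-mathlib` (D-0151), crux H413 = `stmt-HodgeConjecture-24833`, line «N6nsGerm» stub `stub_N6nsR1LL :
RankOneUnstableTransferNonsplitCME`; seat F0P3-p02 (g13) (def lane of the R-1 letters ED. 3∕ED. 4, p842443∕p842970).  HONEST LABEL: HC_CM is proved only modulo the printed
citations until rung 0 closes; nothing here proves the transfer — the letter is a HYPOTHESIS, TRUE by [Rogawski1990, Lemma 4.9.3] ∕ [LabesseLanglands1979, §2] (whose `SL(2)`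
computation on the ramified elliptic torus, Lemma 2.1 with `δ_m = 2q^m` and (2.2) `∫_{|x|<ε} κ = 0`, is uniform in the residue characteristic — MEMO-R1ram §1 (j)).

WHY A RESIDUE.  The closer ★ `rankOneUnstableTransferNonsplitCME_of_core_of_core_tame_of_wild` (p843709, F0P3a-p08 (g15), «R1-RAM-FOLD») assembles `…CME` from the INERT core
(road «R1LL-tree»), the TAMELY ramified core (road «R1-ram»: R-0 ★ p843548 unit similitude, R-1 ★ p843646 unit row, R-2 counts, R-3 window classes, R-4 `Δ` at a ramified place,
I-5a-ram, (R5b-α∕β)) and a third input `hwild` = THIS def, verbatim: every in-house ramified brick carries `h2 : Valued.v (2 : L_w) = 1` by design (anti-fixed uniformiser ★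
`exists_uniformizer_galAdicCompletionMap_eq_neg_of_ramified`, Cayley parameter, Jacobowitz's NON-dyadic normal form), so the dyadic ramified places (`v ∣ 2` ramified in `L ∕ L⁺`)
have no in-house road tonight — a dyadic road would be a new design ([Jacobowitz1962, §§9–11], dyadic hermitian lattices), exactly as «R2EP-wild» for the Euler–Poincaré letter (R2).

THE TEXT.  ★ `RankOneUnstableTransferNonsplitCMERamified` (ED. 4 :319) TOKEN FOR TOKEN with ONE binder inserted right after `¬ Algebra.IsUnramifiedIn (𝓞 L) v.asIdeal →`:
`¬ (∀ w : UnitaryGroup.PlacesOver L v, Valued.v (2 : w.1.adicCompletion L) = 1) →` («the place above `v` is dyadic»; `PlacesOver L v` is a subsingleton at a non-split `v`) — i.e. the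
`hwild` binder of ★ p843709 :71–139, so that `rankOneUnstableTransferNonsplitCMERamified_of_core_tame_of_wild (hcore_tame) (h : RankOneUnstableTransferNonsplitCMERamifiedWild)`
typechecks by `δ`.

* `RankOneUnstableTransferNonsplitCMERamifiedWild` — the residue (closed `def … : Prop`); `rankOneUnstableTransferNonsplitCMERamifiedWild_iff` — its unfolding.

## References
* [Rogawski1990] J. D. Rogawski, *Automorphic Representations of Unitary Groups in Three Variables*, Ann. of Math. Stud. 123 (1990): §4.9 Lemma 4.9.3, (4.9.2) p. 56; §4.3 (4.3.1) p. 43.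
* [LabesseLanglands1979] J.-P. Labesse, R. P. Langlands, *L-indistinguishability for SL(2)*, Canad. J. Math. 31 (1979) 726–785: §2, Lemma 2.1, pp. 5–10.
* [Jacobowitz1962] R. Jacobowitz, *Hermitian forms over local fields*, Amer. J. Math. 84 (1962): §§9–11 (the dyadic ramified case).
-/


noncomputable section

open NumberField IsDedekindDomain MeasureTheory Measure
open Literature.NumberTheory.Automorphic Literature.NumberTheory.GaloisRepresentations
open scoped Matrix MatrixGroups

namespace Literature.NumberTheory.Rogawski1990

/-- **(R1-lc) WILD-RAMIFIED RESIDUE [Rogawski1990 Lemma 4.9.3 p. 56; LabesseLanglands1979 §2]** — ★ `RankOneUnstableTransferNonsplitCMERamified` VERBATIM (μ-guarded, `Reg` stably closed (r1),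
torus elliptic (e1), `¬ Algebra.IsUnramifiedIn (𝓞 L) v`) restricted to the places whose place `w` above `v` is DYADIC (`¬ ∀ w, ‖2‖_w = 1`, i.e. `v ∣ 2` ramified in `L ∕ L⁺`).  For
every CM field `L`, such `v`, unitary `μ` with `μ|_{𝕀_{L⁺}} = ω_{L∕L⁺}`, Haar `ν` on `H_v = U(Φ₂)_v × U(Φ₁)_v`, canonical family `m` on a conjugation- and stably-closed regular set `Reg`,
`f ∈ C_c^∞(H_v)` and elliptic torus `C = Z(t₀)` framed by `P`: a locally constant compactly supported `f^C` on `C` with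
`μ_w(γ₁ − γ₃)⁻¹ · (Π_w ‖γ₁ − γ₃‖_w)^{1∕2} · (2Φ(⟦t⟧, f) − Σᶠ_{st} Φ) = f^C(t)` at every `t ∈ C` with `Reg t`.  The named residue of the books' row «R1-CM-ram» once the tame half is
paid in-house (★ `rankOneUnstableTransferNonsplitCMERamified_of_core_tame_of_wild`). [cite: Rogawski1990, §4.9 Lemma 4.9.3 (4.9.2) p. 56; §4.3 (4.3.1) p. 43] [cite: LabesseLanglands1979, §2] -/
def RankOneUnstableTransferNonsplitCMERamifiedWild : Prop :=
  ∀ (L : Type) [Field L] [NumberField L] [IsCMField L] (v : HeightOneSpectrum (𝓞 ↥(maximalRealSubfield L))),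
    Subsingleton (UnitaryGroup.PlacesOver L v) →
    -- the RAMIFIED residue: `w ∣ v` ramified in `L ∕ L⁺` (the inert half is the in-house road «R1LL-tree»)
    ¬ Algebra.IsUnramifiedIn (𝓞 L) v.asIdeal →
    -- the WILD residue: the place above `v` is DYADIC (`|2|_w < 1`); the tame ramified places are the in-house road «R1-ram»
    ¬ (∀ w : UnitaryGroup.PlacesOver L v, Valued.v (2 : w.1.adicCompletion L) = 1) →
    ∀ (μ : HeckeCharacter L)
      [MeasurableSpace ((UnitaryGroup.cmDatum L 2 (Matrix.of fun i j : Fin 2 => if i.val + j.val + 1 = 2 then (1 : L) else 0)).Local v ×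
        (UnitaryGroup.cmDatum L 1 (Matrix.of fun i j : Fin 1 => if i.val + j.val + 1 = 1 then (1 : L) else 0)).Local v)]
      [BorelSpace ((UnitaryGroup.cmDatum L 2 (Matrix.of fun i j : Fin 2 => if i.val + j.val + 1 = 2 then (1 : L) else 0)).Local v ×
        (UnitaryGroup.cmDatum L 1 (Matrix.of fun i j : Fin 1 => if i.val + j.val + 1 = 1 then (1 : L) else 0)).Local v)]
      (ν : Measure ((UnitaryGroup.cmDatum L 2 (Matrix.of fun i j : Fin 2 => if i.val + j.val + 1 = 2 then (1 : L) else 0)).Local v ×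
        (UnitaryGroup.cmDatum L 1 (Matrix.of fun i j : Fin 1 => if i.val + j.val + 1 = 1 then (1 : L) else 0)).Local v))
      [ν.IsHaarMeasure] [ν.IsMulRightInvariant]
      [_iZ : ∀ γ : (UnitaryGroup.cmDatum L 2 (Matrix.of fun i j : Fin 2 => if i.val + j.val + 1 = 2 then (1 : L) else 0)).Local v ×
          (UnitaryGroup.cmDatum L 1 (Matrix.of fun i j : Fin 1 => if i.val + j.val + 1 = 1 then (1 : L) else 0)).Local v,
        MeasurableSpace (((UnitaryGroup.cmDatum L 2 (Matrix.of fun i j : Fin 2 => if i.val + j.val + 1 = 2 then (1 : L) else 0)).Local v ×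
          (UnitaryGroup.cmDatum L 1 (Matrix.of fun i j : Fin 1 => if i.val + j.val + 1 = 1 then (1 : L) else 0)).Local v) ⧸
          Subgroup.centralizer ({γ} : Set ((UnitaryGroup.cmDatum L 2 (Matrix.of fun i j : Fin 2 => if i.val + j.val + 1 = 2 then (1 : L) else 0)).Local v ×
            (UnitaryGroup.cmDatum L 1 (Matrix.of fun i j : Fin 1 => if i.val + j.val + 1 = 1 then (1 : L) else 0)).Local v)))]
      [_bZ : ∀ γ : (UnitaryGroup.cmDatum L 2 (Matrix.of fun i j : Fin 2 => if i.val + j.val + 1 = 2 then (1 : L) else 0)).Local v ×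
          (UnitaryGroup.cmDatum L 1 (Matrix.of fun i j : Fin 1 => if i.val + j.val + 1 = 1 then (1 : L) else 0)).Local v,
        BorelSpace (((UnitaryGroup.cmDatum L 2 (Matrix.of fun i j : Fin 2 => if i.val + j.val + 1 = 2 then (1 : L) else 0)).Local v ×
          (UnitaryGroup.cmDatum L 1 (Matrix.of fun i j : Fin 1 => if i.val + j.val + 1 = 1 then (1 : L) else 0)).Local v) ⧸
          Subgroup.centralizer ({γ} : Set ((UnitaryGroup.cmDatum L 2 (Matrix.of fun i j : Fin 2 => if i.val + j.val + 1 = 2 then (1 : L) else 0)).Local v ×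
            (UnitaryGroup.cmDatum L 1 (Matrix.of fun i j : Fin 1 => if i.val + j.val + 1 = 1 then (1 : L) else 0)).Local v)))]
      (m : OrbitalMeasureFamily ((UnitaryGroup.cmDatum L 2 (Matrix.of fun i j : Fin 2 => if i.val + j.val + 1 = 2 then (1 : L) else 0)).Local v ×
        (UnitaryGroup.cmDatum L 1 (Matrix.of fun i j : Fin 1 => if i.val + j.val + 1 = 1 then (1 : L) else 0)).Local v)),
      -- ED. 3 THE μ-GUARD (print's `μ`: unitary, `μ|_{𝕀_{L⁺}} = ω_{L∕L⁺}` — the tokens of ★ `LocalTransferExplicitNonsplitClosed`)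
      μ.IsUnitary →
      (∀ x : ideleGroup ↥(maximalRealSubfield L), μ (AdeleRing.ideleBaseChange (↥(maximalRealSubfield L)) L x) = quadraticHeckeCharCM L x) →
      -- the regular set `Reg` (print: `H`-regular; the S2 consumer: `G`-regular): any conjugation-stable sub-predicate of «`U(Φ₂)`-part regular semisimple»
      ∀ (Reg : ((UnitaryGroup.cmDatum L 2 (Matrix.of fun i j : Fin 2 => if i.val + j.val + 1 = 2 then (1 : L) else 0)).Local v ×
          (UnitaryGroup.cmDatum L 1 (Matrix.of fun i j : Fin 1 => if i.val + j.val + 1 = 1 then (1 : L) else 0)).Local v) → Prop),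
        (∀ γ, Reg γ → IsRegularElt (γ.1.val : GL (Fin 2) (UnitaryGroup.LocalRing L v))) → (∀ γ x, Reg γ → Reg (x * γ * x⁻¹)) →
        -- ED. 4 (r1) `Reg` is closed under STABLE conjugacy (so the canonical family is pinned at every class the κ-sum reads)
        (∀ γ δ, Reg γ → IsLocalStablyConjH L v γ δ → Reg δ) →
      m.IsCanonical Reg ν →
      ∀ f : (UnitaryGroup.cmDatum L 2 (Matrix.of fun i j : Fin 2 => if i.val + j.val + 1 = 2 then (1 : L) else 0)).Local v ×
          (UnitaryGroup.cmDatum L 1 (Matrix.of fun i j : Fin 1 => if i.val + j.val + 1 = 1 then (1 : L) else 0)).Local v → ℂ, IsLocSmooth f →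
      -- the torus `C = Z(t₀)`, presented by an eigenframe `P` of the `H`-regular `t₀` (eigenvalues in `E_v`; the column order fixes the embedding `C ↪ H`)
      ∀ (t₀ : (UnitaryGroup.cmDatum L 2 (Matrix.of fun i j : Fin 2 => if i.val + j.val + 1 = 2 then (1 : L) else 0)).Local v ×
          (UnitaryGroup.cmDatum L 1 (Matrix.of fun i j : Fin 1 => if i.val + j.val + 1 = 1 then (1 : L) else 0)).Local v)
        (P : GL (Fin 2) (UnitaryGroup.LocalRing L v)) (d : Fin 2 → UnitaryGroup.LocalRing L v),
        IsRegularElt (t₀.1.val : GL (Fin 2) (UnitaryGroup.LocalRing L v)) →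
        (t₀.1.val.val : Matrix (Fin 2) (Fin 2) (UnitaryGroup.LocalRing L v)) * P.val = P.val * Matrix.diagonal d →
        -- ED. 4 (e1) the torus `C = Z(t₀)` is ELLIPTIC (print's `U(1) × U(1) × U(1)`): the eigenvalues of `t₀.1` are of norm one
        (∀ i, UnitaryGroup.conjLocal L (IsCMField.complexConj L) v (d i) * d i = 1) →
      ∃ fC : ↥(Subgroup.centralizer ({t₀} : Set ((UnitaryGroup.cmDatum L 2 (Matrix.of fun i j : Fin 2 => if i.val + j.val + 1 = 2 then (1 : L) else 0)).Local v ×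
            (UnitaryGroup.cmDatum L 1 (Matrix.of fun i j : Fin 1 => if i.val + j.val + 1 = 1 then (1 : L) else 0)).Local v))) → ℂ,
        IsLocallyConstant fC ∧ HasCompactSupport fC ∧
        ∀ t : ↥(Subgroup.centralizer ({t₀} : Set ((UnitaryGroup.cmDatum L 2 (Matrix.of fun i j : Fin 2 => if i.val + j.val + 1 = 2 then (1 : L) else 0)).Local v ×
            (UnitaryGroup.cmDatum L 1 (Matrix.of fun i j : Fin 1 => if i.val + j.val + 1 = 1 then (1 : L) else 0)).Local v))),
          Reg (t : (UnitaryGroup.cmDatum L 2 (Matrix.of fun i j : Fin 2 => if i.val + j.val + 1 = 2 then (1 : L) else 0)).Local v ×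
            (UnitaryGroup.cmDatum L 1 (Matrix.of fun i j : Fin 1 => if i.val + j.val + 1 = 1 then (1 : L) else 0)).Local v) →
          ((finHeckeValue L v μ
              (((P⁻¹).val * ((t : (UnitaryGroup.cmDatum L 2 (Matrix.of fun i j : Fin 2 => if i.val + j.val + 1 = 2 then (1 : L) else 0)).Local v ×
                (UnitaryGroup.cmDatum L 1 (Matrix.of fun i j : Fin 1 => if i.val + j.val + 1 = 1 then (1 : L) else 0)).Local v).1.val.val :
                  Matrix (Fin 2) (Fin 2) (UnitaryGroup.LocalRing L v)) * P.val) 0 0 -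
               ((P⁻¹).val * ((t : (UnitaryGroup.cmDatum L 2 (Matrix.of fun i j : Fin 2 => if i.val + j.val + 1 = 2 then (1 : L) else 0)).Local v ×
                (UnitaryGroup.cmDatum L 1 (Matrix.of fun i j : Fin 1 => if i.val + j.val + 1 = 1 then (1 : L) else 0)).Local v).1.val.val :
                  Matrix (Fin 2) (Fin 2) (UnitaryGroup.LocalRing L v)) * P.val) 1 1))⁻¹ : ℂ) *
            ((Real.sqrt (∏ w' : UnitaryGroup.PlacesOver L v,
                ‖(((P⁻¹).val * ((t : (UnitaryGroup.cmDatum L 2 (Matrix.of fun i j : Fin 2 => if i.val + j.val + 1 = 2 then (1 : L) else 0)).Local v ×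
                    (UnitaryGroup.cmDatum L 1 (Matrix.of fun i j : Fin 1 => if i.val + j.val + 1 = 1 then (1 : L) else 0)).Local v).1.val.val :
                      Matrix (Fin 2) (Fin 2) (UnitaryGroup.LocalRing L v)) * P.val) 0 0 -
                  ((P⁻¹).val * ((t : (UnitaryGroup.cmDatum L 2 (Matrix.of fun i j : Fin 2 => if i.val + j.val + 1 = 2 then (1 : L) else 0)).Local v ×
                    (UnitaryGroup.cmDatum L 1 (Matrix.of fun i j : Fin 1 => if i.val + j.val + 1 = 1 then (1 : L) else 0)).Local v).1.val.val :
                      Matrix (Fin 2) (Fin 2) (UnitaryGroup.LocalRing L v)) * P.val) 1 1) w'‖) : ℝ) : ℂ) *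
            (2 * classOrbitalIntegral m f (ConjClasses.mk (t : (UnitaryGroup.cmDatum L 2 (Matrix.of fun i j : Fin 2 => if i.val + j.val + 1 = 2 then (1 : L) else 0)).Local v ×
                (UnitaryGroup.cmDatum L 1 (Matrix.of fun i j : Fin 1 => if i.val + j.val + 1 = 1 then (1 : L) else 0)).Local v)) -
              ∑ᶠ d ∈ {d : ConjClasses ((UnitaryGroup.cmDatum L 2 (Matrix.of fun i j : Fin 2 => if i.val + j.val + 1 = 2 then (1 : L) else 0)).Local v ×
                  (UnitaryGroup.cmDatum L 1 (Matrix.of fun i j : Fin 1 => if i.val + j.val + 1 = 1 then (1 : L) else 0)).Local v) |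
                    IsLocalStablyConjH L v (t : (UnitaryGroup.cmDatum L 2 (Matrix.of fun i j : Fin 2 => if i.val + j.val + 1 = 2 then (1 : L) else 0)).Local v ×
                      (UnitaryGroup.cmDatum L 1 (Matrix.of fun i j : Fin 1 => if i.val + j.val + 1 = 1 then (1 : L) else 0)).Local v) (Quotient.out d)},
                classOrbitalIntegral m f d) = fC t

/-- Unfolding of `RankOneUnstableTransferNonsplitCMERamifiedWild` (definitional). [cite: Rogawski1990, §4.9 Lemma 4.9.3 (4.9.2) p. 56] -/
theorem rankOneUnstableTransferNonsplitCMERamifiedWild_iff :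
    RankOneUnstableTransferNonsplitCMERamifiedWild ↔
    ∀ (L : Type) [Field L] [NumberField L] [IsCMField L] (v : HeightOneSpectrum (𝓞 ↥(maximalRealSubfield L))),
      Subsingleton (UnitaryGroup.PlacesOver L v) →
      -- the RAMIFIED residue: `w ∣ v` ramified in `L ∕ L⁺` (the inert half is the in-house road «R1LL-tree»)
      ¬ Algebra.IsUnramifiedIn (𝓞 L) v.asIdeal →
      -- the WILD residue: the place above `v` is DYADIC (`|2|_w < 1`); the tame ramified places are the in-house road «R1-ram»
      ¬ (∀ w : UnitaryGroup.PlacesOver L v, Valued.v (2 : w.1.adicCompletion L) = 1) →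
      ∀ (μ : HeckeCharacter L)
        [MeasurableSpace ((UnitaryGroup.cmDatum L 2 (Matrix.of fun i j : Fin 2 => if i.val + j.val + 1 = 2 then (1 : L) else 0)).Local v ×
          (UnitaryGroup.cmDatum L 1 (Matrix.of fun i j : Fin 1 => if i.val + j.val + 1 = 1 then (1 : L) else 0)).Local v)]
        [BorelSpace ((UnitaryGroup.cmDatum L 2 (Matrix.of fun i j : Fin 2 => if i.val + j.val + 1 = 2 then (1 : L) else 0)).Local v ×
          (UnitaryGroup.cmDatum L 1 (Matrix.of fun i j : Fin 1 => if i.val + j.val + 1 = 1 then (1 : L) else 0)).Local v)]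
        (ν : Measure ((UnitaryGroup.cmDatum L 2 (Matrix.of fun i j : Fin 2 => if i.val + j.val + 1 = 2 then (1 : L) else 0)).Local v ×
          (UnitaryGroup.cmDatum L 1 (Matrix.of fun i j : Fin 1 => if i.val + j.val + 1 = 1 then (1 : L) else 0)).Local v))
        [ν.IsHaarMeasure] [ν.IsMulRightInvariant]
        [_iZ : ∀ γ : (UnitaryGroup.cmDatum L 2 (Matrix.of fun i j : Fin 2 => if i.val + j.val + 1 = 2 then (1 : L) else 0)).Local v ×
            (UnitaryGroup.cmDatum L 1 (Matrix.of fun i j : Fin 1 => if i.val + j.val + 1 = 1 then (1 : L) else 0)).Local v,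
          MeasurableSpace (((UnitaryGroup.cmDatum L 2 (Matrix.of fun i j : Fin 2 => if i.val + j.val + 1 = 2 then (1 : L) else 0)).Local v ×
            (UnitaryGroup.cmDatum L 1 (Matrix.of fun i j : Fin 1 => if i.val + j.val + 1 = 1 then (1 : L) else 0)).Local v) ⧸
            Subgroup.centralizer ({γ} : Set ((UnitaryGroup.cmDatum L 2 (Matrix.of fun i j : Fin 2 => if i.val + j.val + 1 = 2 then (1 : L) else 0)).Local v ×
              (UnitaryGroup.cmDatum L 1 (Matrix.of fun i j : Fin 1 => if i.val + j.val + 1 = 1 then (1 : L) else 0)).Local v)))]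
        [_bZ : ∀ γ : (UnitaryGroup.cmDatum L 2 (Matrix.of fun i j : Fin 2 => if i.val + j.val + 1 = 2 then (1 : L) else 0)).Local v ×
            (UnitaryGroup.cmDatum L 1 (Matrix.of fun i j : Fin 1 => if i.val + j.val + 1 = 1 then (1 : L) else 0)).Local v,
          BorelSpace (((UnitaryGroup.cmDatum L 2 (Matrix.of fun i j : Fin 2 => if i.val + j.val + 1 = 2 then (1 : L) else 0)).Local v ×
            (UnitaryGroup.cmDatum L 1 (Matrix.of fun i j : Fin 1 => if i.val + j.val + 1 = 1 then (1 : L) else 0)).Local v) ⧸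
            Subgroup.centralizer ({γ} : Set ((UnitaryGroup.cmDatum L 2 (Matrix.of fun i j : Fin 2 => if i.val + j.val + 1 = 2 then (1 : L) else 0)).Local v ×
              (UnitaryGroup.cmDatum L 1 (Matrix.of fun i j : Fin 1 => if i.val + j.val + 1 = 1 then (1 : L) else 0)).Local v)))]
        (m : OrbitalMeasureFamily ((UnitaryGroup.cmDatum L 2 (Matrix.of fun i j : Fin 2 => if i.val + j.val + 1 = 2 then (1 : L) else 0)).Local v ×
          (UnitaryGroup.cmDatum L 1 (Matrix.of fun i j : Fin 1 => if i.val + j.val + 1 = 1 then (1 : L) else 0)).Local v)),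
        -- ED. 3 THE μ-GUARD (print's `μ`: unitary, `μ|_{𝕀_{L⁺}} = ω_{L∕L⁺}` — the tokens of ★ `LocalTransferExplicitNonsplitClosed`)
        μ.IsUnitary →
        (∀ x : ideleGroup ↥(maximalRealSubfield L), μ (AdeleRing.ideleBaseChange (↥(maximalRealSubfield L)) L x) = quadraticHeckeCharCM L x) →
        -- the regular set `Reg` (print: `H`-regular; the S2 consumer: `G`-regular): any conjugation-stable sub-predicate of «`U(Φ₂)`-part regular semisimple»
        ∀ (Reg : ((UnitaryGroup.cmDatum L 2 (Matrix.of fun i j : Fin 2 => if i.val + j.val + 1 = 2 then (1 : L) else 0)).Local v ×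
            (UnitaryGroup.cmDatum L 1 (Matrix.of fun i j : Fin 1 => if i.val + j.val + 1 = 1 then (1 : L) else 0)).Local v) → Prop),
          (∀ γ, Reg γ → IsRegularElt (γ.1.val : GL (Fin 2) (UnitaryGroup.LocalRing L v))) → (∀ γ x, Reg γ → Reg (x * γ * x⁻¹)) →
          -- ED. 4 (r1) `Reg` is closed under STABLE conjugacy (so the canonical family is pinned at every class the κ-sum reads)
          (∀ γ δ, Reg γ → IsLocalStablyConjH L v γ δ → Reg δ) →
        m.IsCanonical Reg ν →
        ∀ f : (UnitaryGroup.cmDatum L 2 (Matrix.of fun i j : Fin 2 => if i.val + j.val + 1 = 2 then (1 : L) else 0)).Local v ×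
            (UnitaryGroup.cmDatum L 1 (Matrix.of fun i j : Fin 1 => if i.val + j.val + 1 = 1 then (1 : L) else 0)).Local v → ℂ, IsLocSmooth f →
        -- the torus `C = Z(t₀)`, presented by an eigenframe `P` of the `H`-regular `t₀` (eigenvalues in `E_v`; the column order fixes the embedding `C ↪ H`)
        ∀ (t₀ : (UnitaryGroup.cmDatum L 2 (Matrix.of fun i j : Fin 2 => if i.val + j.val + 1 = 2 then (1 : L) else 0)).Local v ×
            (UnitaryGroup.cmDatum L 1 (Matrix.of fun i j : Fin 1 => if i.val + j.val + 1 = 1 then (1 : L) else 0)).Local v)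
          (P : GL (Fin 2) (UnitaryGroup.LocalRing L v)) (d : Fin 2 → UnitaryGroup.LocalRing L v),
          IsRegularElt (t₀.1.val : GL (Fin 2) (UnitaryGroup.LocalRing L v)) →
          (t₀.1.val.val : Matrix (Fin 2) (Fin 2) (UnitaryGroup.LocalRing L v)) * P.val = P.val * Matrix.diagonal d →
          -- ED. 4 (e1) the torus `C = Z(t₀)` is ELLIPTIC (print's `U(1) × U(1) × U(1)`): the eigenvalues of `t₀.1` are of norm one
          (∀ i, UnitaryGroup.conjLocal L (IsCMField.complexConj L) v (d i) * d i = 1) →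
        ∃ fC : ↥(Subgroup.centralizer ({t₀} : Set ((UnitaryGroup.cmDatum L 2 (Matrix.of fun i j : Fin 2 => if i.val + j.val + 1 = 2 then (1 : L) else 0)).Local v ×
              (UnitaryGroup.cmDatum L 1 (Matrix.of fun i j : Fin 1 => if i.val + j.val + 1 = 1 then (1 : L) else 0)).Local v))) → ℂ,
          IsLocallyConstant fC ∧ HasCompactSupport fC ∧
          ∀ t : ↥(Subgroup.centralizer ({t₀} : Set ((UnitaryGroup.cmDatum L 2 (Matrix.of fun i j : Fin 2 => if i.val + j.val + 1 = 2 then (1 : L) else 0)).Local v ×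
              (UnitaryGroup.cmDatum L 1 (Matrix.of fun i j : Fin 1 => if i.val + j.val + 1 = 1 then (1 : L) else 0)).Local v))),
            Reg (t : (UnitaryGroup.cmDatum L 2 (Matrix.of fun i j : Fin 2 => if i.val + j.val + 1 = 2 then (1 : L) else 0)).Local v ×
              (UnitaryGroup.cmDatum L 1 (Matrix.of fun i j : Fin 1 => if i.val + j.val + 1 = 1 then (1 : L) else 0)).Local v) →
            ((finHeckeValue L v μ
                (((P⁻¹).val * ((t : (UnitaryGroup.cmDatum L 2 (Matrix.of fun i j : Fin 2 => if i.val + j.val + 1 = 2 then (1 : L) else 0)).Local v ×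
                  (UnitaryGroup.cmDatum L 1 (Matrix.of fun i j : Fin 1 => if i.val + j.val + 1 = 1 then (1 : L) else 0)).Local v).1.val.val :
                    Matrix (Fin 2) (Fin 2) (UnitaryGroup.LocalRing L v)) * P.val) 0 0 -
                 ((P⁻¹).val * ((t : (UnitaryGroup.cmDatum L 2 (Matrix.of fun i j : Fin 2 => if i.val + j.val + 1 = 2 then (1 : L) else 0)).Local v ×
                  (UnitaryGroup.cmDatum L 1 (Matrix.of fun i j : Fin 1 => if i.val + j.val + 1 = 1 then (1 : L) else 0)).Local v).1.val.val :
                    Matrix (Fin 2) (Fin 2) (UnitaryGroup.LocalRing L v)) * P.val) 1 1))⁻¹ : ℂ) *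
              ((Real.sqrt (∏ w' : UnitaryGroup.PlacesOver L v,
                  ‖(((P⁻¹).val * ((t : (UnitaryGroup.cmDatum L 2 (Matrix.of fun i j : Fin 2 => if i.val + j.val + 1 = 2 then (1 : L) else 0)).Local v ×
                      (UnitaryGroup.cmDatum L 1 (Matrix.of fun i j : Fin 1 => if i.val + j.val + 1 = 1 then (1 : L) else 0)).Local v).1.val.val :
                        Matrix (Fin 2) (Fin 2) (UnitaryGroup.LocalRing L v)) * P.val) 0 0 -
                    ((P⁻¹).val * ((t : (UnitaryGroup.cmDatum L 2 (Matrix.of fun i j : Fin 2 => if i.val + j.val + 1 = 2 then (1 : L) else 0)).Local v ×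
                      (UnitaryGroup.cmDatum L 1 (Matrix.of fun i j : Fin 1 => if i.val + j.val + 1 = 1 then (1 : L) else 0)).Local v).1.val.val :
                        Matrix (Fin 2) (Fin 2) (UnitaryGroup.LocalRing L v)) * P.val) 1 1) w'‖) : ℝ) : ℂ) *
              (2 * classOrbitalIntegral m f (ConjClasses.mk (t : (UnitaryGroup.cmDatum L 2 (Matrix.of fun i j : Fin 2 => if i.val + j.val + 1 = 2 then (1 : L) else 0)).Local v ×
                  (UnitaryGroup.cmDatum L 1 (Matrix.of fun i j : Fin 1 => if i.val + j.val + 1 = 1 then (1 : L) else 0)).Local v)) -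
                ∑ᶠ d ∈ {d : ConjClasses ((UnitaryGroup.cmDatum L 2 (Matrix.of fun i j : Fin 2 => if i.val + j.val + 1 = 2 then (1 : L) else 0)).Local v ×
                    (UnitaryGroup.cmDatum L 1 (Matrix.of fun i j : Fin 1 => if i.val + j.val + 1 = 1 then (1 : L) else 0)).Local v) |
                      IsLocalStablyConjH L v (t : (UnitaryGroup.cmDatum L 2 (Matrix.of fun i j : Fin 2 => if i.val + j.val + 1 = 2 then (1 : L) else 0)).Local v ×
                        (UnitaryGroup.cmDatum L 1 (Matrix.of fun i j : Fin 1 => if i.val + j.val + 1 = 1 then (1 : L) else 0)).Local v) (Quotient.out d)},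
                  classOrbitalIntegral m f d) = fC t :=
  Iff.rfl

end Literature.NumberTheory.Rogawski1990

end
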